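import Summits.CriticalPhenomena.PercolationContinuityZ3.Theses.PercAxialLogConvexity
import Summits.CriticalPhenomena.PercolationContinuityZ3.Theorems.PercAxialLogConvexityBlockCrossoverStubAxialMass
import Summits.CriticalPhenomena.PercolationContinuityZ3.Theorems.PercAxialLogConvexityBlockCrossoverStubMassVanishes
import Literature.Probability.LatticeModels.CorrelationDecay

/-!
# Line `birth` — registered skeleton for the crux `BlockCrossover`
# (stmt-CriticalPhenomena-11550, route `PercAxialLogConvexity`, rank 3)

Crux (fixed, by name): `PercAxialLogConvexity.BlockCrossover` —
`∃ c' < c, p_k ∈ (0, p_c], N_k unbounded, C_k` with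
(a) `τ_{p_k}(0, n e₁) ≤ C_k e^{-(c/N_k) n}` for all `n`, and
(b) on the dyadic block `N_k/2 ≤ n ≤ N_k`:
`e^{-c'/N_k} τ_{p_k}(0,n e₁) τ_{p_c}(0,(n+1)e₁) ≤ τ_{p_k}(0,(n+1)e₁) τ_{p_c}(0,n e₁)`.

THE LINE (the route's own TWO-LAYER PLAN for this node: `BlockCrossover ⇐ CorrelationLengthDiverges →
RatioCrossover`; the crux text itself says "the first clause holds with `C_k = 1`, `c/N_k = 1/ξ(p_k)`
(Grimmett 1999 Thm (6.44), (6.46)) and `ξ(p) → ∞` as `p ↑ p_c` (ibid. Thm (6.14)); the content is the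
ratio comparison at `n ≍ ξ(p_k)`"). The currency linking the three stubs is the tree's junk-free axial
mass predicate `Literature.Probability.LatticeModels.HasInvCorrLength (tau 3 p 0) m`
(`-log τ_p(0, n e₁)/n → m`, CorrelationDecay.lean), i.e. `m = 1/ξ(p) = φ(p)`:

* `stub_axialMass` (KNOWN, not in tree; Grimmett 1999 Thm (6.44): (6.45) the axial rate exists and
  (6.46) the SHARP a-priori bound `τ_p(0,e_n) ≤ e^{-n φ(p)}` with constant 1, by FKG
  super-multiplicativity `τ(0,e_{m+n}) ≥ τ(0,e_m) τ(0,e_n)` + Fekete; positivity `φ(p) > 0` for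
  `p < p_c` is (6.16), i.e. sharpness — in tree as `SharpnessDCT`): for `0 < p < p_c(ℤ³)` there is
  `m > 0` with `HasInvCorrLength (τ_p(0,·)) m` and `τ_p(0, n e₁) ≤ e^{-m n}` for all `n`. Size M–L.
* `stub_massVanishes` (KNOWN, not in tree; Grimmett 1999 Thm (6.14): (6.15) `φ` continuous on
  `(0,1]` as a uniform limit of finite-volume rates (two-sided subadditivity (6.36), BK), and (6.18)
  `φ(p_c) = 0`; transported to the axial rate by (6.45)): the axial mass tends to `0` as `p ↑ p_c`:
  `∀ ε > 0 ∃ p₀ < p_c ∀ p ∈ (p₀, p_c) ∀ m, HasInvCorrLength (τ_p(0,·)) m → m < ε`. Size L.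
* `stub_ratioCrossover` (OPEN — the content, the hardest stub; = `RatioCrossover` of the route's
  two-layer plan, in its weaker cofinal form): `∃ 0 < c, c' < c` such that cofinally in `p ↑ p_c`
  (for every `p₀ < p_c` some `p ∈ (p₀, p_c)`), with `m` the axial mass of `p` and the scale PINNED to
  the correlation length, `N := ⌈c/m⌉₊ = ⌈c ξ(p)⌉`, the block inequality (b) holds on `N/2 ≤ n ≤ N`.
  In scaling form (`τ_p/τ_{p_c}(tξ) = e^{-D(t)}`, `D(t) ≈ A t^{1/ν}`, `1/ν = 1.141 > 1` in `d = 3`,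
  arXiv:1302.0421) it asks `sup_{t ∈ [c/2, c]} D'(t) ≤ c'/c < 1`, available for small `c` exactly
  because `1/ν > 1` (it would fail in `d = 2`, `ν = 4/3`). Nothing rigorous is known about `τ_p` at
  scale `ξ(p)` on `ℤ³` (GrimmettPercolation1999 §6.2; CampaninoIoffeVelenik2008 is `|x| ≫ ξ`;
  BorgsChayesKestenSpencer1999 needs hyperscaling hypotheses).
* `BlockCrossover_of : Stubs.stub_axialMass → Stubs.stub_massVanishes → Stubs.stub_ratioCrossover →
  BlockCrossover` (the stub `Prop`s BY NAME), PROVED here (no `sorry`): for each `k` take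
  `ε_k := c/(k+1)`, `p₀(ε_k)` from stub 2, the cofinal `p_k ∈ (p₀, p_c)` of stub 3, its mass `m_k`
  and sharp bound from stub 1 (so `m_k < ε_k` by stub 2), `N_k := ⌈c/m_k⌉₊`, `C_k := 1`; then
  (a) is `e^{-m_k n} ≤ e^{-(c/N_k) n}` from `N_k ≥ c/m_k`, unboundedness is `N_k ≥ c/m_k > k+1`,
  and (b) is stub 3 verbatim.
* `BlockCrossover_proof : BlockCrossover := BlockCrossover_of stub_axialMass stub_massVanishes
  stub_ratioCrossover` — the skeleton IS the crux proof once the three sorries are discharged.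

Why the mass predicate is load-bearing (not decoration): if stub 3 quantified over every admissible
rate `m` (any `m` with `τ_p ≤ e^{-mn}`, i.e. any `m ≤ φ(p)`), scales `N = ⌈c/m⌉₊ ≫ ξ(p)` would be
included, where (b) is false (deep-subcritical slopes `≈ -1/ξ` against critical slopes `→ 0`); the
sharp constant-1 bound of stub 1 at THE mass is what lets (a) hold at `N ≍ ξ` (refuter crux-attack
2026-08-15: "(A) pins `N_k ≍ ξ(p_k)`").

Disproof.lean: none filed for this crux (`ledger crux ls stmt-CriticalPhenomena-11550`: no workfiles,
2026-08-17); negatives index of the summit untouched (no statement about near-critical two-point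
crossover). No new route, no restatement of the crux: `BlockCrossover_of` concludes the route decl by
name.
-/

noncomputable section

open Literature.Probability.Percolation Literature.Probability.LatticeModels

namespace Summit.CriticalPhenomena.PercolationContinuityZ3.Cruxes.BlockCrossover.Birth

/-! ## The three registered stubs: precise `Prop`s `Stubs.stub_*` + sorried theorems `stub_*` -/

namespace Stubs

-- Stub `Prop` 1 (`AxialMass`) was `Stubs.stub_axialMass`; it LANDED in wave 1 (p145472) as
-- `Summit.CriticalPhenomena.PercolationContinuityZ3.Theorems.BlockCrossover.stub_axialMass` and is
-- now discharged INSIDE `BlockCrossover_of` (no longer a hypothesis / registered stub).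

-- Stub `Prop` 2 (`MassVanishes`) was `Stubs.stub_massVanishes`; it LANDED in wave 1 (p146881) as
-- `Summit.CriticalPhenomena.PercolationContinuityZ3.Theorems.BlockCrossover.stub_massVanishes` and
-- is now discharged INSIDE `BlockCrossover_of` (no longer a hypothesis / registered stub).

/-- **Stub `Prop` 3 (`RatioCrossover`, OPEN, the hardest stub)** — cofinally in `p ↑ p_c`, at the
scale `N = ⌈c/m⌉₊ = ⌈c ξ(p)⌉` pinned to the axial mass `m` of `p`, critical axial ratios exceed the
subcritical ones by at most `e^{c'/N}` on the dyadic block `N/2 ≤ n ≤ N`, for some `c' < c`. -/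
def stub_ratioCrossover : Prop :=
  ∃ c c' : ℝ, 0 < c ∧ c' < c ∧ ∀ p₀ : unitInterval, p₀ < criticalProbI 3 →
    ∃ p : unitInterval, p₀ < p ∧ p < criticalProbI 3 ∧
      ∀ m : ℝ, 0 < m → HasInvCorrLength (tau 3 p 0) m →
        ∀ n : ℕ, ((⌈c / m⌉₊ : ℕ) : ℝ) ≤ 2 * n → n ≤ ⌈c / m⌉₊ →
          Real.exp (-(c' / (⌈c / m⌉₊ : ℕ))) *
              (tau 3 p 0 (Pi.single 0 (n : ℤ)) *
                tau 3 (criticalProbI 3) 0 (Pi.single 0 ((n + 1 : ℕ) : ℤ))) ≤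
            tau 3 p 0 (Pi.single 0 ((n + 1 : ℕ) : ℤ)) *
              tau 3 (criticalProbI 3) 0 (Pi.single 0 (n : ℤ))

end Stubs

/-- **Former stub 1, LANDED** (wave 1, p145472, file
`Theorems/PercAxialLogConvexityBlockCrossoverStubAxialMass.lean`): for `0 < p < p_c(ℤ³)` the axial
two-point function `τ_p(0, n e₁) = tau 3 p 0 (Pi.single 0 n)` has a mass `m > 0`
(`-log τ_p(0,n e₁)/n → m`, the tree's `HasInvCorrLength`) and satisfies the SHARP a-priori bound
`τ_p(0, n e₁) ≤ e^{-m n}` for every `n` (Grimmett 1999 Thm (6.44) with (6.16); Fekete + Harris +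
the proved sharpness `perc_sharpness_holds`). -/
theorem axialMass :
    ∀ p : unitInterval, 0 < (p : ℝ) → p < criticalProbI 3 →
      ∃ m : ℝ, 0 < m ∧ HasInvCorrLength (tau 3 p 0) m ∧
        ∀ n : ℕ, tau 3 p 0 (Pi.single 0 (n : ℤ)) ≤ Real.exp (-m * n) :=
  Summit.CriticalPhenomena.PercolationContinuityZ3.Theorems.BlockCrossover.stub_axialMass

/-- **Former stub 2, LANDED** (wave 1, p146881, file
`Theorems/PercAxialLogConvexityBlockCrossoverStubMassVanishes.lean`): the axial mass vanishes at
`p_c` from below (`ξ(p) → ∞` as `p ↑ p_c`): for every `ε > 0` there is `p₀ < p_c(ℤ³)` such that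
every `p ∈ (p₀, p_c)` has axial mass `< ε` (upper half of Grimmett 1999 Thm (6.14), obtained from
Kozma–Nachmias Lemma 3.1 at `p_c` + reflection doubling onto the axis + lower semicontinuity in
`p`, without the continuity of `φ`). -/
theorem massVanishes :
    ∀ ε : ℝ, 0 < ε → ∃ p₀ : unitInterval, p₀ < criticalProbI 3 ∧
      ∀ p : unitInterval, p₀ < p → p < criticalProbI 3 →
        ∀ m : ℝ, HasInvCorrLength (tau 3 p 0) m → m < ε :=
  Summit.CriticalPhenomena.PercolationContinuityZ3.Theorems.BlockCrossover.stub_massVanishes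

/-- **stub 3 (registered) = `Stubs.stub_ratioCrossover` spelled out (OPEN; the hardest stub)** —
`RatioCrossover` at the correlation-length scale: there are `0 < c` and `c' < c` such that for
every `p₀ < p_c(ℤ³)` some `p ∈ (p₀, p_c)` satisfies, for its axial mass `m` (`HasInvCorrLength`)
and `N := ⌈c/m⌉₊ = ⌈c ξ(p)⌉`, the block inequality
`e^{-c'/N} τ_p(0,n e₁) τ_{p_c}(0,(n+1)e₁) ≤ τ_p(0,(n+1)e₁) τ_{p_c}(0,n e₁)` for `N/2 ≤ n ≤ N`.
Scaling heuristic (why plausibly true in `d = 3` and why it might fail): with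
`τ_p/τ_{p_c}(tξ) = e^{-D(t)}`, `D(t) ≈ A t^{1/ν}`, the clause reads `sup_{[c/2,c]} D' ≤ c'/c`, and
`D'(t) → 0` as `t → 0` iff `1/ν > 1` (`1/ν = 1.141(2)` on `ℤ³`, arXiv:1302.0421; false for
`ν = 4/3` in `d = 2`); corrections to scaling at finite `ξ` are uncontrolled and no rigorous
near-critical two-point control at scale `ξ(p)` exists on `ℤ³` (GrimmettPercolation1999 §6.2,
CampaninoIoffeVelenik2008, BorgsChayesKestenSpencer1999). Size: open-problem. -/
theorem stub_ratioCrossover :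
    ∃ c c' : ℝ, 0 < c ∧ c' < c ∧ ∀ p₀ : unitInterval, p₀ < criticalProbI 3 →
      ∃ p : unitInterval, p₀ < p ∧ p < criticalProbI 3 ∧
        ∀ m : ℝ, 0 < m → HasInvCorrLength (tau 3 p 0) m →
          ∀ n : ℕ, ((⌈c / m⌉₊ : ℕ) : ℝ) ≤ 2 * n → n ≤ ⌈c / m⌉₊ →
            Real.exp (-(c' / (⌈c / m⌉₊ : ℕ))) *
                (tau 3 p 0 (Pi.single 0 (n : ℤ)) *
                  tau 3 (criticalProbI 3) 0 (Pi.single 0 ((n + 1 : ℕ) : ℤ))) ≤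
              tau 3 p 0 (Pi.single 0 ((n + 1 : ℕ) : ℤ)) *
                tau 3 (criticalProbI 3) 0 (Pi.single 0 (n : ℤ)) := by
  sorry

/-! ## The composition (proved): the three stubs imply the crux BY NAME -/

/-- **`BlockCrossover` from the one remaining stub** (hypothesis = the declared stub `Prop`
`Stubs.stub_ratioCrossover` by name; the landed former stubs `axialMass`, `massVanishes` are used
inside; conclusion = the route decl `PercAxialLogConvexity.BlockCrossover` by name; no `sorry`).
Witnesses: `c, c'` from stub 3; `p_k` = stub 3's cofinal point above `p₀(c/(k+1))` of
`massVanishes`; `N_k := ⌈c/m_k⌉₊` with `m_k` the mass of `p_k` from `axialMass`; `C_k := 1`. -/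
theorem BlockCrossover_of (h3 : Stubs.stub_ratioCrossover) :
    Summit.CriticalPhenomena.PercolationContinuityZ3.Theses.PercAxialLogConvexity.BlockCrossover := by
  classical
  have h1 := axialMass
  have h2 := massVanishes
  unfold Stubs.stub_ratioCrossover at h3
  obtain ⟨c, c', hc, hcc', H⟩ := h3
  -- stub 2 at the tolerances ε_k := c / (k + 1)
  have h2' : ∀ k : ℕ, ∃ p₀ : unitInterval, p₀ < criticalProbI 3 ∧
      ∀ p : unitInterval, p₀ < p → p < criticalProbI 3 →
        ∀ m : ℝ, HasInvCorrLength (tau 3 p 0) m → m < c / ((k : ℝ) + 1) :=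
    fun k => h2 (c / ((k : ℝ) + 1)) (div_pos hc (Nat.cast_add_one_pos k))
  choose p₀ hp₀ hp₀m using h2'
  -- stub 3's cofinal points above each p₀ k
  choose p hp₁ hp₂ hblk using fun k => H (p₀ k) (hp₀ k)
  have hppos : ∀ k, 0 < (p k : ℝ) := fun k =>
    lt_of_le_of_lt (unitInterval.nonneg (p₀ k)) (Subtype.coe_lt_coe.2 (hp₁ k))
  -- stub 1's masses and sharp bounds at the points p k
  choose m hm hmicl hbd using fun k => h1 (p k) (hppos k) (hp₂ k)
  have hmlt : ∀ k, m k < c / ((k : ℝ) + 1) := fun k =>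
    hp₀m k (p k) (hp₁ k) (hp₂ k) (m k) (hmicl k)
  refine ⟨c, c', hcc', p, fun k => ⌈c / m k⌉₊, fun _ => 1, ?_, ?_, ?_, ?_⟩
  · -- 0 < p_k ≤ p_c
    intro k
    exact ⟨hppos k, (hp₂ k).le⟩
  · -- the scales are unbounded: N_M ≥ c / m_M > M + 1
    intro M
    refine ⟨M, ?_⟩
    show M ≤ ⌈c / m M⌉₊
    have hMlt : (M : ℝ) + 1 < c / m M := by
      rw [lt_div_iff₀ (hm M)]
      have h' := (lt_div_iff₀ (Nat.cast_add_one_pos M)).1 (hmlt M)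
      linarith
    have hceil : c / m M ≤ ((⌈c / m M⌉₊ : ℕ) : ℝ) := Nat.le_ceil _
    have : (M : ℝ) ≤ ((⌈c / m M⌉₊ : ℕ) : ℝ) := by linarith
    exact_mod_cast this
  · -- clause (a): e^{-m_k n} ≤ 1 · e^{-(c/N_k) n} since c / N_k ≤ m_k
    intro k n
    show tau 3 (p k) 0 (Pi.single 0 (n : ℤ)) ≤
      1 * Real.exp (-(c / ((⌈c / m k⌉₊ : ℕ) : ℝ)) * n)
    have hNpos : (0 : ℝ) < ((⌈c / m k⌉₊ : ℕ) : ℝ) := by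
      have : 0 < ⌈c / m k⌉₊ := Nat.ceil_pos.2 (div_pos hc (hm k))
      exact_mod_cast this
    have hrate : c / ((⌈c / m k⌉₊ : ℕ) : ℝ) ≤ m k := by
      rw [div_le_iff₀ hNpos]
      have h0 : c / m k ≤ ((⌈c / m k⌉₊ : ℕ) : ℝ) := Nat.le_ceil _
      rw [div_le_iff₀ (hm k)] at h0
      linarith
    have hn : (0 : ℝ) ≤ n := n.cast_nonneg
    have hmono : -(m k) * n ≤ -(c / ((⌈c / m k⌉₊ : ℕ) : ℝ)) * n := by
      have := mul_le_mul_of_nonneg_right hrate hn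
      linarith
    calc tau 3 (p k) 0 (Pi.single 0 (n : ℤ)) ≤ Real.exp (-(m k) * n) := hbd k n
      _ ≤ Real.exp (-(c / ((⌈c / m k⌉₊ : ℕ) : ℝ)) * n) := Real.exp_le_exp.2 hmono
      _ = 1 * Real.exp (-(c / ((⌈c / m k⌉₊ : ℕ) : ℝ)) * n) := (one_mul _).symm
  · -- clause (b): stub 3 verbatim at N_k = ⌈c / m_k⌉₊
    intro k n hNn hnN
    exact hblk k (m k) (hm k) (hmicl k) n hNn hnN

/-- **The skeleton IS the crux proof** (D-0027 §3.3): `BlockCrossover` from the three registered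
stubs; sorry-free as soon as `stub_axialMass`, `stub_massVanishes`, `stub_ratioCrossover` are
discharged. -/
theorem BlockCrossover_proof :
    Summit.CriticalPhenomena.PercolationContinuityZ3.Theses.PercAxialLogConvexity.BlockCrossover :=
  BlockCrossover_of stub_ratioCrossover

end Summit.CriticalPhenomena.PercolationContinuityZ3.Cruxes.BlockCrossover.Birth

end
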